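import Mathlib
import HarnessLib
import Summits.ValiantsHypothesis.ValiantsHypothesis.Theorems.LacunarySymmetroidMatrixDescartesProductPlusOneCrossingSign

/-!
# ValiantsHypothesis / LacunarySymmetroid — crux `MatrixDescartes` (stmt-ValiantsHypothesis-18050, V1),
# LINE (A) «product_plus_one», floor: consecutive zeros of the Euler polynomial are SEPARATED by a negative value of the log-Wronskian

Kernel form of val-idea-25 g3's AB5-1 («distinct up-crossings lie in distinct components of `{N > 0}`»), for EVERY polynomial `P`, every
level `ν`, `E = X·P′ − C ν·P`, and the θ-Laguerre / log-Wronskian expression `N = W(P) = P·X(XP′)′ − (XP′)²` (✓ `theta_wronskian_prod`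
computes it for products, ✓ `crossing_sign` evaluates it at the zeros of `E`):

* `X_mul_eulerWronskian_eq` — the polynomial identity `X·(E′·P − E·P′) = W(P)` (the level `ν` drops out): `N/P²` is `x·(E/P)′`;
* ★ `exists_wronskian_neg_between_zeros` — if `E ≠ 0` and `P` has no zero on `[z, z′]` (`0 < z < z′`, `E(z) = E(z′) = 0`), then
  `W(P)(w) < 0` at some `w ∈ (z, z′)` (mean value theorem for `E/P`, which cannot vanish identically);
* ★ `exists_wronskian_pos_between_zeros` — likewise `W(P)(w′) > 0` at some `w′ ∈ (z, z′)`.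

So inside one pole-free window any two zeros of `E` are separated by a point of `{N < 0}` AND by a point of `{N > 0}`: the zeros of `E` in the
window and the sign changes of `N` interlace — with ✓ `euler_roots_Icc_le_budget` this is the counting frame of the located law
«`V_I ≤ π_I` = #components of `{N > 0} ∩ I`» (AB5-1), whose research half is the bound on `π`.
HONEST FRAMING: calculus; bounds nothing by itself; NOT `OneChangeFloorK3`, not `stub_classRowK3`, not `stub_polyLaw`, not `MatrixDescartes`,
not Conjecture B; `VP ≠ VNP` is NOT proved.  No definitions, no named facts.
-/

set_option linter.dupNamespace false

namespace Summit.ValiantsHypothesis.ValiantsHypothesis.Theorems.LacunarySymmetroidMatrixDescartes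

namespace ProductPlusOne

open Polynomial Finset
open scoped BigOperators Topology

/-- **`X·(E′P − E P′) = W(P)`** for `E = X·P′ − C ν·P` and `W(P) = P·X(XP′)′ − (XP′)²` — the level drops out. [folklore] -/
theorem X_mul_eulerWronskian_eq (P : ℝ[X]) (ν : ℝ) :
    (X : ℝ[X]) * (derivative (X * derivative P - C ν * P) * P - (X * derivative P - C ν * P) * derivative P)
      = P * (X * derivative (X * derivative P)) - (X * derivative P) ^ 2 := by
  simp only [derivative_sub, derivative_mul, derivative_X, derivative_C, zero_mul, zero_add, one_mul]
  ring

/-- Between two zeros `z < z′` of `E` with no zero of `P` on `[z, z′]`, and `E ≠ 0`: the quotient `E/P` has a point of NEGATIVE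
derivative and a point of POSITIVE derivative in `(z, z′)`. [folklore; mean value theorem] -/
theorem exists_deriv_quot_neg_and_pos_between_zeros (E P : ℝ[X]) (hE : E ≠ 0) {z z' : ℝ} (hzz' : z < z')
    (hP : ∀ t ∈ Set.Icc z z', P.eval t ≠ 0) (hEz : E.eval z = 0) (hEz' : E.eval z' = 0) :
    (∃ w ∈ Set.Ioo z z', (derivative E).eval w * P.eval w - E.eval w * (derivative P).eval w < 0) ∧
    (∃ w ∈ Set.Ioo z z', 0 < (derivative E).eval w * P.eval w - E.eval w * (derivative P).eval w) := by
  let g : ℝ → ℝ := fun y => E.eval y / P.eval y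
  have hderiv : ∀ t, P.eval t ≠ 0 → HasDerivAt g
      (((derivative E).eval t * P.eval t - E.eval t * (derivative P).eval t) / (P.eval t) ^ 2) t :=
    fun t hPt => (Polynomial.hasDerivAt E t).div (Polynomial.hasDerivAt P t) hPt
  have hgz : g z = 0 := by show E.eval z / P.eval z = 0; rw [hEz, zero_div]
  have hgz' : g z' = 0 := by show E.eval z' / P.eval z' = 0; rw [hEz', zero_div]
  -- `g` is not identically zero on `(z, z')`: otherwise `E` has infinitely many roots
  have hne : ∃ c ∈ Set.Ioo z z', g c ≠ 0 := by
    by_contra h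
    push Not at h
    apply hE
    apply Polynomial.eq_zero_of_infinite_isRoot
    apply Set.Infinite.mono (s := Set.Ioo z z')
    · intro t ht
      have hPt := hP t ⟨ht.1.le, ht.2.le⟩
      have := h t ht
      change E.eval t / P.eval t = 0 at this
      rcases div_eq_zero_iff.mp this with h0 | h0
      · exact h0
      · exact absurd h0 hPt
    · exact Set.Ioo_infinite hzz'
  obtain ⟨c, hc, hgc⟩ := hne
  -- mean value theorem on `[z, c]` and on `[c, z']`
  have hcont : ∀ a b, z ≤ a → b ≤ z' → ContinuousOn g (Set.Icc a b) := fun a b ha hb =>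
    ContinuousOn.div (Polynomial.continuous E).continuousOn (Polynomial.continuous P).continuousOn
      (fun t ht => hP t ⟨ha.trans ht.1, ht.2.trans hb⟩)
  have hdiff : ∀ a b, z ≤ a → b ≤ z' → DifferentiableOn ℝ g (Set.Ioo a b) := fun a b ha hb t ht =>
    (hderiv t (hP t ⟨ha.trans ht.1.le, ht.2.le.trans hb⟩)).differentiableAt.differentiableWithinAt
  obtain ⟨w₁, hw₁, hw₁'⟩ := exists_deriv_eq_slope g hc.1 (hcont z c le_rfl hc.2.le) (hdiff z c le_rfl hc.2.le)
  obtain ⟨w₂, hw₂, hw₂'⟩ := exists_deriv_eq_slope g hc.2 (hcont c z' hc.1.le le_rfl) (hdiff c z' hc.1.le le_rfl)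
  rw [hgz, sub_zero] at hw₁'
  rw [hgz', zero_sub] at hw₂'
  have hw₁I : w₁ ∈ Set.Ioo z z' := ⟨hw₁.1, hw₁.2.trans hc.2⟩
  have hw₂I : w₂ ∈ Set.Ioo z z' := ⟨hc.1.trans hw₂.1, hw₂.2⟩
  have hPw₁ : P.eval w₁ ≠ 0 := hP w₁ ⟨hw₁I.1.le, hw₁I.2.le⟩
  have hPw₂ : P.eval w₂ ≠ 0 := hP w₂ ⟨hw₂I.1.le, hw₂I.2.le⟩
  have hd₁ := (hderiv w₁ hPw₁).deriv
  have hd₂ := (hderiv w₂ hPw₂).deriv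
  -- sign of the numerator = sign of the derivative (denominator `P² > 0`)
  have key : ∀ w, P.eval w ≠ 0 → ∀ s : ℝ, deriv g w = s →
      ((derivative E).eval w * P.eval w - E.eval w * (derivative P).eval w) = s * (P.eval w) ^ 2 := by
    intro w hPw s hs
    rw [(hderiv w hPw).deriv] at hs
    have hP2 : (P.eval w) ^ 2 ≠ 0 := pow_ne_zero _ hPw
    field_simp at hs
    linarith [hs]
  rcases lt_or_gt_of_ne hgc with hneg | hpos
  · -- `g c < 0`: slope on `[z,c]` negative, on `[c,z']` positive
    refine ⟨⟨w₁, hw₁I, ?_⟩, ⟨w₂, hw₂I, ?_⟩⟩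
    · rw [key w₁ hPw₁ _ hw₁']
      exact mul_neg_of_neg_of_pos (div_neg_of_neg_of_pos hneg (by linarith [hc.1])) (sq_pos_iff.mpr hPw₁)
    · rw [key w₂ hPw₂ _ hw₂']
      exact mul_pos (div_pos (by linarith) (by linarith [hc.2])) (sq_pos_iff.mpr hPw₂)
  · refine ⟨⟨w₂, hw₂I, ?_⟩, ⟨w₁, hw₁I, ?_⟩⟩
    · rw [key w₂ hPw₂ _ hw₂']
      exact mul_neg_of_neg_of_pos (div_neg_of_neg_of_pos (by linarith) (by linarith [hc.2])) (sq_pos_iff.mpr hPw₂)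
    · rw [key w₁ hPw₁ _ hw₁']
      exact mul_pos (div_pos hpos (by linarith [hc.1])) (sq_pos_iff.mpr hPw₁)

/-- ★ **Two zeros of `E = X·P′ − C ν·P` inside a pole-free window `[z,z′] ⊂ (0,∞)` are separated by a point where the log-Wronskian
`W(P) = P·X(XP′)′ − (XP′)²` is NEGATIVE** (`E ≠ 0`). [this file's theorem; val-idea-25 AB5-1] -/
theorem exists_wronskian_neg_between_zeros (P : ℝ[X]) (ν : ℝ) (hE : (X * derivative P - C ν * P : ℝ[X]) ≠ 0) {z z' : ℝ}
    (hz : 0 < z) (hzz' : z < z') (hP : ∀ t ∈ Set.Icc z z', P.eval t ≠ 0)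
    (hEz : (X * derivative P - C ν * P : ℝ[X]).eval z = 0) (hEz' : (X * derivative P - C ν * P : ℝ[X]).eval z' = 0) :
    ∃ w ∈ Set.Ioo z z', (P * (X * derivative (X * derivative P)) - (X * derivative P) ^ 2).eval w < 0 := by
  obtain ⟨⟨w, hw, hneg⟩, _⟩ := exists_deriv_quot_neg_and_pos_between_zeros _ P hE hzz' hP hEz hEz'
  refine ⟨w, hw, ?_⟩
  have hid := congrArg (Polynomial.eval w) (X_mul_eulerWronskian_eq P ν)
  rw [← hid, eval_mul, eval_X, eval_sub, eval_mul, eval_mul]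
  exact mul_neg_of_pos_of_neg (hz.trans hw.1) hneg

/-- ★ **… and by a point where `W(P)` is POSITIVE.** [this file's theorem] -/
theorem exists_wronskian_pos_between_zeros (P : ℝ[X]) (ν : ℝ) (hE : (X * derivative P - C ν * P : ℝ[X]) ≠ 0) {z z' : ℝ}
    (hz : 0 < z) (hzz' : z < z') (hP : ∀ t ∈ Set.Icc z z', P.eval t ≠ 0)
    (hEz : (X * derivative P - C ν * P : ℝ[X]).eval z = 0) (hEz' : (X * derivative P - C ν * P : ℝ[X]).eval z' = 0) :
    ∃ w ∈ Set.Ioo z z', 0 < (P * (X * derivative (X * derivative P)) - (X * derivative P) ^ 2).eval w := by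
  obtain ⟨_, ⟨w, hw, hpos⟩⟩ := exists_deriv_quot_neg_and_pos_between_zeros _ P hE hzz' hP hEz hEz'
  refine ⟨w, hw, ?_⟩
  have hid := congrArg (Polynomial.eval w) (X_mul_eulerWronskian_eq P ν)
  rw [← hid, eval_mul, eval_X, eval_sub, eval_mul, eval_mul]
  exact mul_pos (hz.trans hw.1) hpos

end ProductPlusOne

end Summit.ValiantsHypothesis.ValiantsHypothesis.Theorems.LacunarySymmetroidMatrixDescartes
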